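import Mathlib
import Summits.Ventures.GridStability.Models.StructurePreserving
import Literature.MathematicalPhysics.PowerSystems.SinusoidalCouplingSectorBound
import Literature.MathematicalPhysics.PowerSystems.StrictSectorBound

/-!
# GridStability/Models/StructurePreservingEnergy — sign and quadratic comparison of the
# topological Lyapunov function of the structure-preserving model

LADDER-GRIDFUSION rung G3, seat gridfusion-model-2, v0 2026-08-26. Companion to
`Models/StructurePreserving.lean` (the Bergen–Hill model, MODEL-VALIDITY row MV-3): there the
printed energy function `energy = kinetic + potential` [cite: Padiyar2013, §3.2 eqs (3.11)–(3.14)];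
[cite: BergenHill1981] was typed and its dissipation identity dE/dt = −Σ Dᵢ δ̇ᵢ² proved, with NO
positivity claim. This file proves the two elementary comparison facts that make it a Lyapunov
CANDIDATE on the principal region, branch by branch:

* `branchEnergy_nonneg`: for a reference branch angle `|σ₀| ≤ π/2` and a current angle with
  `|σ + σ₀| ≤ π`, the branch energy `∫_{σ₀}^{σ} (sin β − sin σ₀) dβ` is `≥ 0` — the integrand has
  the sign of `β − σ₀` by the sector bound of
  `Literature.MathematicalPhysics.PowerSystems.SinusoidalCoupling.sector_nonneg` (Vu–Turitsyn's
  hypothesis `|δ*_kj| ≤ π/2`, typed and proved by gridfusion-lit-1);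
* `branchEnergy_le_sq_half`: `branchEnergy σ σ₀ ≤ (σ − σ₀)²/2` for all angles (sin is
  1-Lipschitz, `Real.abs_sin_sub_sin_le`);

and lifts them to `potential_nonneg`, `potential_le_quadratic`, `kinetic_nonneg`, `energy_nonneg`
for nonnegative couplings `bᵢⱼ ≥ 0` (susceptive branches). THREE COLUMNS: these are theorems about
the typed MODEL MV-3 (mathematics, kernel-checked); they are not certificates for any benchmark
and say nothing about any grid. What they give the SOS seats (memo §3D «quadratic / LFF tier»): on
the polytope {|σ_k + σ_k0| ≤ π} the printed V is sandwiched between `½ ω_gᵀ M_g ω_g` and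
`½ ω_gᵀ M_g ω_g + ¼ Σᵢⱼ bᵢⱼ (Δσᵢⱼ)²`, exactly the comparison a quadratic Lyapunov-function family
starts from. Deliberately NOT here: strict positivity / properness modulo the rotational symmetry
(needs connectivity of the coupling graph), and any sublevel-set statement (certificates' job).
-/

noncomputable section

open Finset Real
open Literature.MathematicalPhysics.PowerSystems.SinusoidalCoupling (sector_nonneg)

namespace Summit.Ventures.GridStability.Models.StructurePreserving.Params

variable {n : ℕ}

/-- Sign of the branch-energy integrand to the right of the reference angle: for `|σ₀| ≤ π/2`,
`σ₀ ≤ β` and `β + σ₀ ≤ π`, `0 ≤ sin β − sin σ₀` (from the sector bound `sector_nonneg`). -/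
theorem sin_sub_sin_nonneg_of_le {β σ₀ : ℝ} (h0 : |σ₀| ≤ π / 2) (hle : σ₀ ≤ β)
    (hP : β + σ₀ ≤ π) : 0 ≤ Real.sin β - Real.sin σ₀ := by
  rcases hle.eq_or_lt with h | h
  · simp [h]
  · have hPabs : |β + σ₀| ≤ π := by
      rw [abs_le]
      constructor
      · have := (abs_le.mp h0).1
        linarith [Real.pi_pos]
      · exact hP
    have hs := sector_nonneg h0 hPabs
    by_contra hneg
    have hlt : Real.sin β - Real.sin σ₀ < 0 := lt_of_not_ge hneg
    nlinarith [mul_pos (sub_pos.mpr h) (neg_pos.mpr hlt)]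

/-- Sign of the branch-energy integrand to the left of the reference angle: for `|σ₀| ≤ π/2`,
`β ≤ σ₀` and `−π ≤ β + σ₀`, `sin β − sin σ₀ ≤ 0`. -/
theorem sin_sub_sin_nonpos_of_le {β σ₀ : ℝ} (h0 : |σ₀| ≤ π / 2) (hle : β ≤ σ₀)
    (hP : -π ≤ β + σ₀) : Real.sin β - Real.sin σ₀ ≤ 0 := by
  rcases hle.eq_or_lt with h | h
  · simp [h]
  · have hPabs : |β + σ₀| ≤ π := by
      rw [abs_le]
      constructor
      · exact hP
      · have := (abs_le.mp h0).2
        linarith [Real.pi_pos]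
    have hs := sector_nonneg h0 hPabs
    by_contra hneg
    have hlt : 0 < Real.sin β - Real.sin σ₀ := lt_of_not_ge hneg
    nlinarith [mul_pos (sub_pos.mpr h) hlt]

/-- **Branch energy is nonnegative on the principal region**: if the reference branch angle
satisfies `|σ₀| ≤ π/2` and the current angle `|σ + σ₀| ≤ π`, then
`0 ≤ branchEnergy σ σ₀ = ∫_{σ₀}^{σ} (sin β − sin σ₀) dβ`. -/
theorem branchEnergy_nonneg {σ σ₀ : ℝ} (h0 : |σ₀| ≤ π / 2) (hP : |σ + σ₀| ≤ π) :
    0 ≤ branchEnergy σ σ₀ := by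
  rw [branchEnergy_eq_integral]
  rcases le_total σ₀ σ with hle | hle
  · refine intervalIntegral.integral_nonneg hle fun β hβ => ?_
    exact sin_sub_sin_nonneg_of_le h0 hβ.1 (by linarith [hβ.2, (abs_le.mp hP).2])
  · have hneg : 0 ≤ ∫ β in σ..σ₀, -(Real.sin β - Real.sin σ₀) := by
      refine intervalIntegral.integral_nonneg hle fun β hβ => ?_
      have := sin_sub_sin_nonpos_of_le h0 hβ.2 (by linarith [hβ.1, (abs_le.mp hP).1])
      linarith
    rw [intervalIntegral.integral_neg] at hneg
    rw [intervalIntegral.integral_symm]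
    exact hneg

/-- **Quadratic upper bound for the branch energy** (all angles): `branchEnergy σ σ₀ ≤ (σ − σ₀)²/2`,
because `|sin β − sin σ₀| ≤ |β − σ₀|`. -/
theorem branchEnergy_le_sq_half (σ σ₀ : ℝ) : branchEnergy σ σ₀ ≤ (σ - σ₀) ^ 2 / 2 := by
  have hq : (σ - σ₀) ^ 2 / 2 = ∫ β in σ₀..σ, (β - σ₀) := by
    rw [intervalIntegral.integral_sub intervalIntegral.intervalIntegrable_id
      intervalIntegrable_const, integral_id, intervalIntegral.integral_const, smul_eq_mul]
    ring
  have hi1 : IntervalIntegrable (fun β : ℝ => β - σ₀) MeasureTheory.volume σ₀ σ :=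
    (continuous_id.sub continuous_const).intervalIntegrable _ _
  have hi2 : IntervalIntegrable (fun β : ℝ => Real.sin β - Real.sin σ₀) MeasureTheory.volume σ₀ σ :=
    (Real.continuous_sin.sub continuous_const).intervalIntegrable _ _
  rw [branchEnergy_eq_integral, hq, ← sub_nonneg, ← intervalIntegral.integral_sub hi1 hi2]
  rcases le_total σ₀ σ with hle | hle
  · refine intervalIntegral.integral_nonneg hle fun β hβ => ?_
    have h1 : |Real.sin β - Real.sin σ₀| ≤ |β - σ₀| := Real.abs_sin_sub_sin_le β σ₀
    rw [abs_of_nonneg (sub_nonneg.mpr hβ.1)] at h1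
    linarith [(abs_le.mp h1).2]
  · have hneg : 0 ≤ ∫ β in σ..σ₀, -((β - σ₀) - (Real.sin β - Real.sin σ₀)) := by
      refine intervalIntegral.integral_nonneg hle fun β hβ => ?_
      have h1 : |Real.sin β - Real.sin σ₀| ≤ |β - σ₀| := Real.abs_sin_sub_sin_le β σ₀
      rw [abs_of_nonpos (sub_nonpos.mpr hβ.2)] at h1
      linarith [(abs_le.mp h1).1]
    rw [intervalIntegral.integral_neg] at hneg
    rw [intervalIntegral.integral_symm]
    exact hneg

/-- **The printed potential energy is nonnegative on the principal region**: for susceptive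
couplings `bᵢⱼ ≥ 0`, reference branch angles `|δ₀ᵢ − δ₀ⱼ| ≤ π/2` and current angles with
`|(δᵢ − δⱼ) + (δ₀ᵢ − δ₀ⱼ)| ≤ π` on every coupled pair, `0 ≤ W(δ, δ₀)`. -/
theorem potential_nonneg (p : Params n) {δ₀ δ : Fin n → ℝ} (hb : ∀ i j, 0 ≤ p.b i j)
    (h0 : ∀ i j, p.b i j ≠ 0 → |δ₀ i - δ₀ j| ≤ π / 2)
    (hP : ∀ i j, p.b i j ≠ 0 → |(δ i - δ j) + (δ₀ i - δ₀ j)| ≤ π) :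
    0 ≤ p.potential δ₀ δ := by
  refine mul_nonneg (by norm_num) (Finset.sum_nonneg fun i _ => Finset.sum_nonneg fun j _ => ?_)
  by_cases hij : p.b i j = 0
  · simp [hij]
  · exact mul_nonneg (hb i j) (branchEnergy_nonneg (h0 i j hij) (hP i j hij))

/-- **Quadratic upper bound for the printed potential energy** (all angles, `bᵢⱼ ≥ 0`):
`W(δ, δ₀) ≤ ½ Σᵢ Σⱼ bᵢⱼ ((δᵢ − δⱼ) − (δ₀ᵢ − δ₀ⱼ))²/2`. -/
theorem potential_le_quadratic (p : Params n) (δ₀ δ : Fin n → ℝ) (hb : ∀ i j, 0 ≤ p.b i j) :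
    p.potential δ₀ δ
      ≤ (1 / 2) * ∑ i, ∑ j, p.b i j * (((δ i - δ j) - (δ₀ i - δ₀ j)) ^ 2 / 2) := by
  refine mul_le_mul_of_nonneg_left (Finset.sum_le_sum fun i _ => Finset.sum_le_sum fun j _ =>
    mul_le_mul_of_nonneg_left (branchEnergy_le_sq_half _ _) (hb i j)) (by norm_num)

/-- Kinetic energy is nonnegative when the generator inertias are (printed: `Mᵢ > 0`). -/
theorem kinetic_nonneg (p : Params n) (hM : ∀ i ∈ p.gen, 0 ≤ p.M i) (ω : Fin n → ℝ) :
    0 ≤ p.kinetic ω :=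
  mul_nonneg (by norm_num) (Finset.sum_nonneg fun i hi => mul_nonneg (hM i hi) (sq_nonneg _))

/-- **The topological Lyapunov function is nonnegative on the principal region** (well-formed
data, susceptive couplings, reference branch angles within `π/2`, current branch angles with
`|σ + σ₀| ≤ π`): `0 ≤ V(δ, ω)`. Together with `hasDerivAt_energy` (dV/dt = −Σ Dᵢ δ̇ᵢ² ≤ 0) this is
the printed Lyapunov-candidate property of [cite: BergenHill1981] for MODEL MV-3; strictness and
sublevel-set compactness are NOT claimed here. -/
theorem energy_nonneg {p : Params n} (hp : p.WellFormed) (hb : ∀ i j, 0 ≤ p.b i j)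
    {δ₀ δ : Fin n → ℝ} (h0 : ∀ i j, p.b i j ≠ 0 → |δ₀ i - δ₀ j| ≤ π / 2)
    (hP : ∀ i j, p.b i j ≠ 0 → |(δ i - δ j) + (δ₀ i - δ₀ j)| ≤ π) (ω : Fin n → ℝ) :
    0 ≤ p.energy δ₀ δ ω :=
  add_nonneg (p.kinetic_nonneg (fun i hi => (hp.M_pos i hi).le) ω) (p.potential_nonneg hb h0 hP)

/-! ## Quadratic LOWER bound on the window `|σ| ≤ π/2` — the «LFF / quadratic tier»
(appended 2026-08-26 by model-2 g2). Source of the inequality: the STRICT sector bound of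
[cite: VuTuritsyn2017, §IV-A] `g(δ*)(δ − δ*)² ≤ (δ − δ*)(sin δ − sin δ*)` on `|δ| ≤ π/2`,
`g(δ*) = (1 − sin|δ*|)/(π/2 − |δ*|) > 0`, typed AND proved by gridfusion-lit-1 in
`Literature.MathematicalPhysics.PowerSystems.SinusoidalCoupling.strictSector_lower`
(with `sectorGain_antitone`, `sectorGain_pos`). Integrating it along a branch gives
`g(σ₀)·(σ − σ₀)²/2 ≤ branchEnergy σ σ₀`, so on the polytope {|σ_k| ≤ π/2} with reference angles
`|σ_k0| ≤ θ < π/2` the printed potential energy of MODEL MV-3 is sandwiched between two explicit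
quadratic forms in the branch-angle deviations: `g(θ)·Q ≤ W ≤ Q`, `Q = ½ Σᵢ Σⱼ bᵢⱼ (Δσᵢⱼ)²/2` —
the comparison a quadratic Lyapunov-function family (memo §3D lever; Vu–Turitsyn's LFF) starts
from. THREE COLUMNS: mathematics about the typed model; no certificate, no grid claim; positive
DEFINITENESS modulo the rotational symmetry still needs connectivity of the coupling graph and is
not claimed. -/

/-- Strict sector bound, divided form, to the right of the reference angle: for `|σ₀| < π/2`,
`|β| ≤ π/2` and `σ₀ ≤ β`, `g(σ₀)·(β − σ₀) ≤ sin β − sin σ₀`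
[cite: VuTuritsyn2017, §IV-A display (bound)]. -/
theorem gain_mul_le_sin_sub_sin {β σ₀ : ℝ} (h0 : |σ₀| < π / 2) (hβ : |β| ≤ π / 2) (hle : σ₀ ≤ β) :
    (1 - Real.sin |σ₀|) / (π / 2 - |σ₀|) * (β - σ₀) ≤ Real.sin β - Real.sin σ₀ := by
  have hs := Literature.MathematicalPhysics.PowerSystems.SinusoidalCoupling.strictSector_lower h0 hβ
  rcases eq_or_lt_of_le hle with heq | hlt
  · subst heq; simp
  · have hx : 0 < β - σ₀ := sub_pos.mpr hlt
    have h' : (1 - Real.sin |σ₀|) / (π / 2 - |σ₀|) * (β - σ₀) * (β - σ₀)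
        ≤ (Real.sin β - Real.sin σ₀) * (β - σ₀) := by
      have e1 : (1 - Real.sin |σ₀|) / (π / 2 - |σ₀|) * (β - σ₀) * (β - σ₀)
          = (1 - Real.sin |σ₀|) / (π / 2 - |σ₀|) * (β - σ₀) ^ 2 := by ring
      have e2 : (Real.sin β - Real.sin σ₀) * (β - σ₀) = (β - σ₀) * (Real.sin β - Real.sin σ₀) := by
        ring
      rw [e1, e2]
      exact hs
    exact le_of_mul_le_mul_right h' hx

/-- Strict sector bound, divided form, to the left of the reference angle: for `|σ₀| < π/2`,
`|β| ≤ π/2` and `β ≤ σ₀`, `sin β − sin σ₀ ≤ g(σ₀)·(β − σ₀)` (both sides nonpositive)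
[cite: VuTuritsyn2017, §IV-A display (bound)]. -/
theorem sin_sub_sin_le_gain_mul {β σ₀ : ℝ} (h0 : |σ₀| < π / 2) (hβ : |β| ≤ π / 2) (hle : β ≤ σ₀) :
    Real.sin β - Real.sin σ₀ ≤ (1 - Real.sin |σ₀|) / (π / 2 - |σ₀|) * (β - σ₀) := by
  have hs := Literature.MathematicalPhysics.PowerSystems.SinusoidalCoupling.strictSector_lower h0 hβ
  rcases eq_or_lt_of_le hle with heq | hlt
  · subst heq; simp
  · have hx : 0 < σ₀ - β := sub_pos.mpr hlt
    have h' : (Real.sin β - Real.sin σ₀) * (σ₀ - β)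
        ≤ (1 - Real.sin |σ₀|) / (π / 2 - |σ₀|) * (β - σ₀) * (σ₀ - β) := by
      have e1 : (1 - Real.sin |σ₀|) / (π / 2 - |σ₀|) * (β - σ₀) * (σ₀ - β)
          = -((1 - Real.sin |σ₀|) / (π / 2 - |σ₀|) * (β - σ₀) ^ 2) := by ring
      have e2 : (Real.sin β - Real.sin σ₀) * (σ₀ - β) = -((β - σ₀) * (Real.sin β - Real.sin σ₀)) := by
        ring
      rw [e1, e2]
      exact neg_le_neg hs
    exact le_of_mul_le_mul_right h' hx

/-- **Quadratic lower bound for the branch energy on the window** `|σ| ≤ π/2`, `|σ₀| < π/2`: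
`g(σ₀)·(σ − σ₀)²/2 ≤ branchEnergy σ σ₀ = ∫_{σ₀}^{σ}(sin β − sin σ₀)dβ`, `g(σ₀) = (1 − sin|σ₀|)/(π/2 − |σ₀|)`
— the integrated strict sector bound [cite: VuTuritsyn2017, §IV-A]; [cite: Padiyar2013, §3.2 eq (3.13)]. -/
theorem branchEnergy_ge_quadratic {σ σ₀ : ℝ} (h0 : |σ₀| < π / 2) (hσ : |σ| ≤ π / 2) :
    (1 - Real.sin |σ₀|) / (π / 2 - |σ₀|) * ((σ - σ₀) ^ 2 / 2) ≤ branchEnergy σ σ₀ := by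
  set g := (1 - Real.sin |σ₀|) / (π / 2 - |σ₀|) with hg
  obtain ⟨h0lo, h0hi⟩ := abs_lt.mp h0
  obtain ⟨hσlo, hσhi⟩ := abs_le.mp hσ
  have hq : g * ((σ - σ₀) ^ 2 / 2) = ∫ β in σ₀..σ, g * (β - σ₀) := by
    rw [intervalIntegral.integral_const_mul, intervalIntegral.integral_sub
      intervalIntegral.intervalIntegrable_id intervalIntegrable_const, integral_id,
      intervalIntegral.integral_const, smul_eq_mul]
    ring
  have hi1 : IntervalIntegrable (fun β : ℝ => g * (β - σ₀)) MeasureTheory.volume σ₀ σ :=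
    (continuous_const.mul (continuous_id.sub continuous_const)).intervalIntegrable _ _
  have hi2 : IntervalIntegrable (fun β : ℝ => Real.sin β - Real.sin σ₀) MeasureTheory.volume σ₀ σ :=
    (Real.continuous_sin.sub continuous_const).intervalIntegrable _ _
  rw [branchEnergy_eq_integral, hq, ← sub_nonneg, ← intervalIntegral.integral_sub hi2 hi1]
  rcases le_total σ₀ σ with hle | hle
  · refine intervalIntegral.integral_nonneg hle fun β hβ => ?_
    have hβ' : |β| ≤ π / 2 := abs_le.mpr ⟨by linarith [hβ.1], by linarith [hβ.2]⟩
    linarith [gain_mul_le_sin_sub_sin h0 hβ' hβ.1]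
  · have hneg : 0 ≤ ∫ β in σ..σ₀, -((Real.sin β - Real.sin σ₀) - g * (β - σ₀)) := by
      refine intervalIntegral.integral_nonneg hle fun β hβ => ?_
      have hβ' : |β| ≤ π / 2 := abs_le.mpr ⟨by linarith [hβ.1], by linarith [hβ.2]⟩
      linarith [sin_sub_sin_le_gain_mul h0 hβ' hβ.2]
    rw [intervalIntegral.integral_neg] at hneg
    rw [intervalIntegral.integral_symm]
    exact hneg

/-- **Strictness**: on the same window the branch energy vanishes only at the reference angle —
`0 < branchEnergy σ σ₀` for `σ ≠ σ₀` (from the quadratic lower bound and `g(σ₀) > 0`,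
`sectorGain_pos`). -/
theorem branchEnergy_pos {σ σ₀ : ℝ} (h0 : |σ₀| < π / 2) (hσ : |σ| ≤ π / 2) (hne : σ ≠ σ₀) :
    0 < branchEnergy σ σ₀ := by
  have hg : 0 < (1 - Real.sin |σ₀|) / (π / 2 - |σ₀|) :=
    Literature.MathematicalPhysics.PowerSystems.SinusoidalCoupling.sectorGain_pos (abs_nonneg _) h0
  have hsq : 0 < (σ - σ₀) ^ 2 / 2 := by
    have : 0 < (σ - σ₀) ^ 2 := by positivity
    linarith
  exact lt_of_lt_of_le (mul_pos hg hsq) (branchEnergy_ge_quadratic h0 hσ)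

/-- **Quadratic lower bound for the printed potential energy** (the LFF comparison of MODEL MV-3):
for susceptive couplings `bᵢⱼ ≥ 0`, reference branch angles `|δ₀ᵢ − δ₀ⱼ| ≤ θ` on every coupled
pair with `0 ≤ θ < π/2` (the source's `λ(δ*) ≤ γ < π/2`), and current branch angles
`|δᵢ − δⱼ| ≤ π/2` on every coupled pair (the polytope `P`),
`g(θ) · ½ Σᵢ Σⱼ bᵢⱼ ((δᵢ − δⱼ) − (δ₀ᵢ − δ₀ⱼ))²/2 ≤ W(δ, δ₀)` with the uniform gain
`g(θ) = (1 − sin θ)/(π/2 − θ)` («g_kj ≥ g», `sectorGain_antitone`)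
[cite: VuTuritsyn2017, §IV-A]; [cite: Padiyar2013, §3.2 eqs (3.12)–(3.13)]. -/
theorem potential_ge_quadratic (p : Params n) {δ₀ δ : Fin n → ℝ} (hb : ∀ i j, 0 ≤ p.b i j)
    {θ : ℝ} (hθ0 : 0 ≤ θ) (hθ : θ < π / 2)
    (h0 : ∀ i j, p.b i j ≠ 0 → |δ₀ i - δ₀ j| ≤ θ)
    (hP : ∀ i j, p.b i j ≠ 0 → |δ i - δ j| ≤ π / 2) :
    (1 - Real.sin θ) / (π / 2 - θ)
        * ((1 / 2) * ∑ i, ∑ j, p.b i j * (((δ i - δ j) - (δ₀ i - δ₀ j)) ^ 2 / 2))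
      ≤ p.potential δ₀ δ := by
  set gθ := (1 - Real.sin θ) / (π / 2 - θ) with hgθ
  have hgθ0 : 0 ≤ gθ :=
    (Literature.MathematicalPhysics.PowerSystems.SinusoidalCoupling.sectorGain_pos hθ0 hθ).le
  unfold potential
  rw [← mul_assoc, mul_comm gθ (1 / 2), mul_assoc, Finset.mul_sum]
  refine mul_le_mul_of_nonneg_left (Finset.sum_le_sum fun i _ => ?_) (by norm_num)
  rw [Finset.mul_sum]
  refine Finset.sum_le_sum fun j _ => ?_
  by_cases hij : p.b i j = 0
  · simp [hij]
  · have h0ij : |δ₀ i - δ₀ j| < π / 2 := lt_of_le_of_lt (h0 i j hij) hθ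
    -- uniform gain ≤ branch gain ≤ branch energy / quadratic
    have hga : gθ ≤ (1 - Real.sin |δ₀ i - δ₀ j|) / (π / 2 - |δ₀ i - δ₀ j|) :=
      Literature.MathematicalPhysics.PowerSystems.SinusoidalCoupling.sectorGain_antitone
        (abs_nonneg _) (h0 i j hij) hθ
    have hbr := branchEnergy_ge_quadratic h0ij (hP i j hij)
    have hq0 : 0 ≤ ((δ i - δ j) - (δ₀ i - δ₀ j)) ^ 2 / 2 := by positivity
    calc gθ * (p.b i j * (((δ i - δ j) - (δ₀ i - δ₀ j)) ^ 2 / 2))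
        = p.b i j * (gθ * (((δ i - δ j) - (δ₀ i - δ₀ j)) ^ 2 / 2)) := by ring
      _ ≤ p.b i j * ((1 - Real.sin |δ₀ i - δ₀ j|) / (π / 2 - |δ₀ i - δ₀ j|)
            * (((δ i - δ j) - (δ₀ i - δ₀ j)) ^ 2 / 2)) :=
          mul_le_mul_of_nonneg_left (mul_le_mul_of_nonneg_right hga hq0) (hb i j)
      _ ≤ p.b i j * branchEnergy (δ i - δ j) (δ₀ i - δ₀ j) :=
          mul_le_mul_of_nonneg_left hbr (hb i j)

/-- **Two-sided quadratic comparison of the topological Lyapunov function** on the window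
(well-formed data, susceptive couplings, `|δ₀ᵢ − δ₀ⱼ| ≤ θ < π/2` and `|δᵢ − δⱼ| ≤ π/2` on coupled
pairs): `kinetic + g(θ)·Q ≤ V ≤ kinetic + Q` with `Q = ½ Σᵢ Σⱼ bᵢⱼ (Δσᵢⱼ)²/2` — the lower half
is `potential_ge_quadratic`, the upper half `potential_le_quadratic`. MODEL MV-3 only. -/
theorem energy_quadratic_sandwich {p : Params n} (hb : ∀ i j, 0 ≤ p.b i j)
    {δ₀ δ : Fin n → ℝ} {θ : ℝ} (hθ0 : 0 ≤ θ) (hθ : θ < π / 2)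
    (h0 : ∀ i j, p.b i j ≠ 0 → |δ₀ i - δ₀ j| ≤ θ)
    (hP : ∀ i j, p.b i j ≠ 0 → |δ i - δ j| ≤ π / 2) (ω : Fin n → ℝ) :
    p.kinetic ω + (1 - Real.sin θ) / (π / 2 - θ)
          * ((1 / 2) * ∑ i, ∑ j, p.b i j * (((δ i - δ j) - (δ₀ i - δ₀ j)) ^ 2 / 2))
        ≤ p.energy δ₀ δ ω
      ∧ p.energy δ₀ δ ω
        ≤ p.kinetic ω + (1 / 2) * ∑ i, ∑ j, p.b i j * (((δ i - δ j) - (δ₀ i - δ₀ j)) ^ 2 / 2) :=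
  ⟨by unfold energy; linarith [p.potential_ge_quadratic hb hθ0 hθ h0 hP],
   by unfold energy; linarith [p.potential_le_quadratic δ₀ δ hb]⟩

end Summit.Ventures.GridStability.Models.StructurePreserving.Params

end
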